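import Mathlib
import Summits.ResolutionOfSingularities.ResolutionOfSingularities.Theorems.WildQuotientsWildQuotientResolutionBlowupExitBasicOpenSections
import Summits.ResolutionOfSingularities.ResolutionOfSingularities.Theorems.WildQuotientsWildQuotientResolutionJordanFiveChartW2Side
import Summits.ResolutionOfSingularities.ResolutionOfSingularities.Theorems.WildQuotientsWildQuotientResolutionJordanFourTwistedChartAction

/-!
# RUNG V5 (`J₅`), brick B7/HP₂ — (W₂-B) the RANGE CONVERSION on `B_{W₂} = (k[x][I₁₂t])_{(i₂³t·(2j₃)²t)}`

(crux stmt-ResolutionOfSingularities-15640 `WildQuotients.WildQuotientResolution`, line `Sketch`;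
chain w45c RUNG V5 `JordanFive.jordanFive_hasResolution_of_bricks'` (p536385), brick `HP₂`
(res-L1-w45c-plan-1 NAMING 14:26:03Z «lead-1 = (W₂-B) the range conversion, stub-5 = (W₂-A) the
ring iso»; letters of res-D-pv-033 AS res-L1-w45c-stub-5 13:58:03Z (a)(b)(c) = the `Hring` binder of
`JordanFive.brickH₂_of_ringSide` p537070). [OURS · L1 W4.5c] — assembly of landed decls; NOT a
statement of any manuscript (Hironaka 2017 is consumed nowhere). Prover res-L1-w45c-lead-1.
AI-written Lean, kernel-checked; weaker than expert review.)

* `BlowupExit.map_away_fixed_iff_of_intertwines` — the GENERIC range conversion for a finite cyclic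
  group `⟨σ⟩ ≤ Aut_k(A)`: on the homogeneous localisation `(A[It])_{(s)}`, `s = w·tᵐ` with `σ w = w`,
  for graded endomorphisms `φ_g` with the coefficient law (`φ_g` maps coefficients by `g⁻¹`) and any
  INJECTIVE model `e : (A[It])_{(s)} → S` with `e(w/1)` a non-zero-divisor and a ring map
  `Σ : S → S` intertwining `σ` (`Σ (e (r/1)) = e ((σ r)/1)`):
  `(∀ g, φ_g • y = y) ↔ Σ (e y) = e y`. Engine: stub-5's `map_away_eq_of_intertwines_deg`
  (p510259) in degree `m`, once at `g = σ⁻¹` (⇒) and once at every `g = σ^{-m'}` with `Σ^{m'}` (⇐).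
* `JordanFive.chartW₂_fixed_iff_of_intertwines` — the instance at the `W₂` section
  `s₂ = i₂³t · (2j₃)²t` (degree `2`; the coefficient `i₂³(2j₃)²` is `σ`-invariant by
  `map_iTwo`/`map_jThreeTwo`), for any injective ring model `e' : B_{W₂} → U`.
* `JordanFive.chartW₂_coverFixed_iff` — the same in the letters of the ORDER: for
  `eE : B_{W₂} ≃+* ↥E` (`E` a `k`-subalgebra of a `k`-algebra `U`, e.g. the `τ_U`-fixed subalgebra of
  the `μ₂`-cover ring `U₂`), `σ_U : U ≃ₐ[k] U`, a map `πc : k[x] → U` (e.g. `π ∘ coverSubst`) with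
  `hbase : eE (F/1) = πc F`, the intertwining `σ_U (πc F) = πc (σ F)` (036's
  `cover_apply_algebraMap_coverSubst`, p538197) and `πc (i₂³(2j₃)²)` a non-zero-divisor:
  `σ_U (eE y) = eE y ↔ ∀ g, HomogeneousLocalization.map (φ g) (hP g) y = y`.
-/

-- single-problem summit: the doubled namespace component `ResolutionOfSingularities` is forced
set_option linter.dupNamespace false

noncomputable section

open MvPolynomial Polynomial HomogeneousLocalization Literature.AlgebraicGeometry.Resolution

namespace Summit.ResolutionOfSingularities.ResolutionOfSingularities.Theorems.WildQuotientResolution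

namespace BlowupExit

universe u

/-- Iterating a fixed point of an algebra automorphism: `(σ ^ m) w = w`. [folklore] -/
theorem algEquiv_pow_apply_eq_self {k : Type*} [CommSemiring k] {A : Type*} [Semiring A]
    [Algebra k A] (σ : A ≃ₐ[k] A) {w : A} (hw : σ w = w) (m : ℕ) : (σ ^ m) w = w := by
  induction m with
  | zero => rw [pow_zero, AlgEquiv.one_apply]
  | succ m ih => rw [pow_succ, AlgEquiv.mul_apply, hw, ih]

/-- Iterating a fixed point of a ring endomorphism: `(Σ ^ m) u = u`. [folklore] -/
theorem ringHom_pow_apply_eq_self {S : Type*} [Semiring S] (Sg : S →+* S) {u : S} (hu : Sg u = u)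
    (m : ℕ) : (Sg ^ m) u = u := by
  induction m with
  | zero => rw [pow_zero, RingHom.coe_one, id_eq]
  | succ m ih => rw [pow_succ, RingHom.coe_mul, Function.comp_apply, hu, ih]

/-- Iterating an intertwining `Σ (θ r) = θ (σ r)`: `(Σ ^ m) (θ r) = θ ((σ ^ m) r)`. [folklore] -/
theorem ringHom_pow_apply_of_intertwines {k : Type*} [CommSemiring k] {A : Type*} [Semiring A]
    [Algebra k A] (σ : A ≃ₐ[k] A) {S : Type*} [Semiring S] (θ : A → S) (Sg : S →+* S)
    (h : ∀ r, Sg (θ r) = θ (σ r)) (m : ℕ) (r : A) : (Sg ^ m) (θ r) = θ ((σ ^ m) r) := by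
  induction m generalizing r with
  | zero => rw [pow_zero, pow_zero, RingHom.coe_one, id_eq, AlgEquiv.one_apply]
  | succ m ih =>
    rw [pow_succ, pow_succ, RingHom.coe_mul, Function.comp_apply, AlgEquiv.mul_apply, h, ih]

/-- **The generic range conversion for a finite cyclic group `⟨σ⟩`** on `(A[It])_{(s)}`,
`s = w·tᵐ`, `σ w = w`: for graded endomorphisms `φ_g` (`g ∈ ⟨σ⟩`) mapping coefficients by `g⁻¹`
and preserving the powers of `s`, an injective ring model `e : (A[It])_{(s)} → S` with `e (w/1)` a
non-zero-divisor, and `Σ : S →+* S` with `Σ (e (r/1)) = e ((σ r)/1)` for all `r`: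
`(∀ g, HomogeneousLocalization.map (φ g) _ y = y) ↔ Σ (e y) = e y`. [OURS · L1 W4.5c] [folklore] -/
theorem map_away_fixed_iff_of_intertwines {k : Type*} [CommSemiring k] {A : Type u} [CommRing A]
    [Algebra k A] (σ : A ≃ₐ[k] A) [Finite (Subgroup.zpowers σ)] {I : Ideal A}
    (s : reesAlgebra I) {m : ℕ} (hs : s ∈ reesGrading I m) (w : A)
    (hsw : (s : A[X]) = monomial m w) (hw : σ w = w)
    (φ : (Subgroup.zpowers σ) → (reesGrading I →+*ᵍ reesGrading I))
    (hφ : ∀ (g : Subgroup.zpowers σ) x, ((φ g x : reesAlgebra I) : A[X]) =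
      (x : A[X]).map ((MulSemiringAction.toRingEquiv (Subgroup.zpowers σ) A g⁻¹ : A ≃+* A) :
        A →+* A))
    (hP : ∀ g, Submonoid.powers s ≤ (Submonoid.powers s).comap (φ g))
    {S : Type*} [CommRing S] (e : HomogeneousLocalization.Away (reesGrading I) s →+* S)
    (he : Function.Injective e)
    (hnzd : e (((fromZeroRingHom (reesGrading I) (.powers s)).comp (reesGrading.zeroRingHom I)) w) ∈
      nonZeroDivisors S)
    (Sg : S →+* S)
    (hSg : ∀ r, Sg (e (((fromZeroRingHom (reesGrading I) (.powers s)).comp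
        (reesGrading.zeroRingHom I)) r)) =
      e (((fromZeroRingHom (reesGrading I) (.powers s)).comp (reesGrading.zeroRingHom I)) (σ r)))
    (y : HomogeneousLocalization.Away (reesGrading I) s) :
    (∀ g, HomogeneousLocalization.map (φ g) (hP g) y = y) ↔ Sg (e y) = e y := by
  -- the E-engine at every `g`, with `Σ^{m'}` where `g⁻¹ = σ^{m'}`
  have hengine : ∀ g : Subgroup.zpowers σ, ∃ m' : ℕ,
      ∀ y, e (HomogeneousLocalization.map (φ g) (hP g) y) = (Sg ^ m') (e y) := by
    intro g
    obtain ⟨m', hm'⟩ := JordanFour.exists_coe_zpowers_eq_pow σ g⁻¹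
    refine ⟨m', fun y => ?_⟩
    have hτ : ∀ r, MulSemiringAction.toRingEquiv (Subgroup.zpowers σ) A g⁻¹ r = (σ ^ m') r :=
      fun r => by rw [JordanFour.toRingEquiv_zpowers_apply, hm']
    refine map_away_eq_of_intertwines_deg s hs w hsw (φ g) _ (hφ g) ?_ (hP g) e hnzd (Sg ^ m') ?_ y
    · show MulSemiringAction.toRingEquiv (Subgroup.zpowers σ) A g⁻¹ w = w
      rw [hτ, algEquiv_pow_apply_eq_self σ hw m']
    · intro r
      show (Sg ^ m') (e (((fromZeroRingHom (reesGrading I) (.powers s)).comp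
          (reesGrading.zeroRingHom I)) r)) =
        e (((fromZeroRingHom (reesGrading I) (.powers s)).comp (reesGrading.zeroRingHom I))
          (MulSemiringAction.toRingEquiv (Subgroup.zpowers σ) A g⁻¹ r))
      rw [hτ, ringHom_pow_apply_of_intertwines σ _ Sg hSg m' r]
  constructor
  · intro h
    -- at `g = σ⁻¹` the coefficient map is `σ` itself and `Σ` intertwines it
    let g₀ : Subgroup.zpowers σ := ⟨σ, Subgroup.mem_zpowers σ⟩
    have h1 := map_away_eq_of_intertwines_deg s hs w hsw (φ g₀⁻¹) _ (hφ g₀⁻¹)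
      (show MulSemiringAction.toRingEquiv (Subgroup.zpowers σ) A (g₀⁻¹)⁻¹ w = w by
        rw [inv_inv]; exact hw) (hP g₀⁻¹) e hnzd Sg
      (fun r => show Sg (e (((fromZeroRingHom (reesGrading I) (.powers s)).comp
          (reesGrading.zeroRingHom I)) r)) =
        e (((fromZeroRingHom (reesGrading I) (.powers s)).comp (reesGrading.zeroRingHom I))
          (MulSemiringAction.toRingEquiv (Subgroup.zpowers σ) A (g₀⁻¹)⁻¹ r)) by
        rw [inv_inv]; exact hSg r) y
    rw [h g₀⁻¹] at h1
    exact h1.symm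
  · intro h g
    obtain ⟨m', hm⟩ := hengine g
    apply he
    rw [hm, ringHom_pow_apply_eq_self Sg h m']

end BlowupExit

namespace JordanFive

variable (k : Type) [Field k] (n : ℕ) (a b c d e : Fin n)

/-- The section `s₂ = i₂³t · (2j₃)²t` defining `chartW₂`. -/
local notation3 "sW₂" => (reesT (iTwo k n a b c d e ^ 3) (iTwo_cube_mem_I12 k n a b c d e) *
  reesT (jThreeTwo k n a b c d e ^ 2) (jThreeTwo_sq_mem_I12 k n a b c d e))
/-- The chart ring `B_{W₂} = (k[x][I₁₂t])_{(s₂)}`. -/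
local notation3 "BW₂" => HomogeneousLocalization.Away (reesGrading (I12 k n a b c d)) sW₂
/-- The base map `F ↦ F/1`. -/
local notation3 "base₂" => ((HomogeneousLocalization.fromZeroRingHom (reesGrading (I12 k n a b c d))
    (.powers sW₂)).comp (reesGrading.zeroRingHom (I12 k n a b c d)))

/-- **(W₂-B), ring-model form.** On `B_{W₂}`, for the seam's graded family `φ` (coefficient law
`hφ`, powers clause `hP`) and ANY injective ring model `e' : B_{W₂} → U` with `e' (i₂³(2j₃)²/1)` a
non-zero-divisor and a ring map `Σ : U → U` with `Σ (e' (F/1)) = e' ((σ F)/1)`: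
`(∀ g, HomogeneousLocalization.map (φ g) _ y = y) ↔ Σ (e' y) = e' y`. [OURS · L1 W4.5c] [folklore;
assembly of landed decls] -/
theorem chartW₂_fixed_iff_of_intertwines
    (σ : MvPolynomial (Fin n) k ≃ₐ[k] MvPolynomial (Fin n) k) [Finite ↥(Subgroup.zpowers σ)]
    (hab : a ≠ b) (hac : a ≠ c) (had : a ≠ d) (hae : a ≠ e)
    (hb : σ (X b) = X b + X a) (hc : σ (X c) = X c + X b) (hd : σ (X d) = X d + X c)
    (he : σ (X e) = X e + X d)
    (hσ : ∀ i, i ≠ b → i ≠ c → i ≠ d → i ≠ e → σ (X i) = X i)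
    (φ : ↥(Subgroup.zpowers σ) → (reesGrading (I12 k n a b c d) →+*ᵍ reesGrading (I12 k n a b c d)))
    (hφ : ∀ (g : ↥(Subgroup.zpowers σ)) x, ((φ g x : reesAlgebra (I12 k n a b c d)) :
        (MvPolynomial (Fin n) k)[X]) =
      (x : (MvPolynomial (Fin n) k)[X]).map ((MulSemiringAction.toRingEquiv
        (↥(Subgroup.zpowers σ)) (MvPolynomial (Fin n) k) g⁻¹ : _ ≃+* _) : _ →+* _))
    (hP : ∀ g, Submonoid.powers sW₂ ≤ (Submonoid.powers sW₂).comap (φ g))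
    {U : Type*} [CommRing U] (e' : BW₂ →+* U) (he' : Function.Injective e')
    (hnzd : e' (base₂ (iTwo k n a b c d e ^ 3 * jThreeTwo k n a b c d e ^ 2)) ∈ nonZeroDivisors U)
    (Sg : U →+* U) (hSg : ∀ F, Sg (e' (base₂ F)) = e' (base₂ (σ F))) (y : BW₂) :
    (∀ g, HomogeneousLocalization.map (φ g) (hP g) y = y) ↔ Sg (e' y) = e' y := by
  have hσa : σ (X a) = X a := hσ a hab hac had hae
  have hi : σ (iTwo k n a b c d e) = iTwo k n a b c d e :=
    map_iTwo k n a b c d e (σ : MvPolynomial (Fin n) k →ₐ[k] MvPolynomial (Fin n) k) hσa hb hc hd he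
  have hj : σ (jThreeTwo k n a b c d e) = jThreeTwo k n a b c d e :=
    map_jThreeTwo k n a b c d e (σ : MvPolynomial (Fin n) k →ₐ[k] MvPolynomial (Fin n) k)
      hσa hb hc hd he
  have hw : σ (iTwo k n a b c d e ^ 3 * jThreeTwo k n a b c d e ^ 2) =
      iTwo k n a b c d e ^ 3 * jThreeTwo k n a b c d e ^ 2 := by
    rw [map_mul, map_pow, map_pow, hi, hj]
  exact BlowupExit.map_away_fixed_iff_of_intertwines σ sW₂ (chartW₂_section_mem k n a b c d e) _
    (coe_chartW₂_section k n a b c d e) hw φ hφ hP e' he' hnzd Sg hSg y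

/-- **(W₂-B) `JordanFive.chartW₂_coverFixed_iff`, in the letters of the ORDER** (plan-1 14:26:03Z):
for `eE : B_{W₂} ≃+* ↥E` onto a `k`-subalgebra `E` of a `k`-algebra `U` (the `τ_U`-fixed subalgebra
of the `μ₂`-cover ring `U₂` in (W₂-A)), `σ_U : U ≃ₐ[k] U`, a map `πc : k[x] → U`
(`F ↦ π (coverSubst F)`) with `eE (F/1) = πc F`, the intertwining `σ_U (πc F) = πc (σ F)` (036's
`cover_apply_algebraMap_coverSubst`) and `πc (i₂³(2j₃)²)` a non-zero-divisor of `U`: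
`σ_U (eE y) = eE y ↔ ∀ g, HomogeneousLocalization.map (φ g) (hP g) y = y`. [OURS · L1 W4.5c]
[folklore; assembly of landed decls] -/
theorem chartW₂_coverFixed_iff
    (σ : MvPolynomial (Fin n) k ≃ₐ[k] MvPolynomial (Fin n) k) [Finite ↥(Subgroup.zpowers σ)]
    (hab : a ≠ b) (hac : a ≠ c) (had : a ≠ d) (hae : a ≠ e)
    (hb : σ (X b) = X b + X a) (hc : σ (X c) = X c + X b) (hd : σ (X d) = X d + X c)
    (he : σ (X e) = X e + X d)
    (hσ : ∀ i, i ≠ b → i ≠ c → i ≠ d → i ≠ e → σ (X i) = X i)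
    (φ : ↥(Subgroup.zpowers σ) → (reesGrading (I12 k n a b c d) →+*ᵍ reesGrading (I12 k n a b c d)))
    (hφ : ∀ (g : ↥(Subgroup.zpowers σ)) x, ((φ g x : reesAlgebra (I12 k n a b c d)) :
        (MvPolynomial (Fin n) k)[X]) =
      (x : (MvPolynomial (Fin n) k)[X]).map ((MulSemiringAction.toRingEquiv
        (↥(Subgroup.zpowers σ)) (MvPolynomial (Fin n) k) g⁻¹ : _ ≃+* _) : _ →+* _))
    (hP : ∀ g, Submonoid.powers sW₂ ≤ (Submonoid.powers sW₂).comap (φ g))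
    {U : Type*} [CommRing U] [Algebra k U] (E : Subalgebra k U) (eE : BW₂ ≃+* ↥E)
    (σU : U ≃ₐ[k] U) (πc : MvPolynomial (Fin n) k → U)
    (hbase : ∀ F, ((eE (base₂ F) : ↥E) : U) = πc F)
    (hπc : ∀ F, σU (πc F) = πc (σ F))
    (hnzd : πc (iTwo k n a b c d e ^ 3 * jThreeTwo k n a b c d e ^ 2) ∈ nonZeroDivisors U)
    (y : BW₂) :
    σU ((eE y : ↥E) : U) = ((eE y : ↥E) : U) ↔
      ∀ g, HomogeneousLocalization.map (φ g) (hP g) y = y := by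
  let e' : BW₂ →+* U := E.val.toRingHom.comp eE.toRingHom
  have he' : ∀ y, e' y = ((eE y : ↥E) : U) := fun _ => rfl
  have hinj : Function.Injective e' := Subtype.val_injective.comp eE.injective
  have h := chartW₂_fixed_iff_of_intertwines k n a b c d e σ hab hac had hae hb hc hd he hσ φ hφ hP
    e' hinj (by rw [he', hbase]; exact hnzd) (σU : U →+* U)
    (fun F => show σU (e' (base₂ F)) = e' (base₂ (σ F)) by rw [he', he', hbase, hbase, hπc]) y
  rw [he'] at h
  exact h.symm

end JordanFive

end Summit.ResolutionOfSingularities.ResolutionOfSingularities.Theorems.WildQuotientResolution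

end
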